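import Mathlib
import Summits.ValiantsHypothesis.ValiantsHypothesis.Theorems.RigidityForcesSymmetryRankRigidMinimalReprLaplaceFiveSeparatedCaptureLineInTwoPlanes
import Summits.ValiantsHypothesis.ValiantsHypothesis.Theorems.RigidityForcesSymmetryRankRigidMinimalReprLaplaceFiveSeparatedCaptureSpanTools

/-!
# ValiantsHypothesis / RigidityForcesSymmetry — crux `LaplaceOptimalFive` (stmt-ValiantsHypothesis-24813), symmetric capture:
# ★★ **THE PENCIL-PLUS-GENERATOR COUNT** `finrank W ≤ 5 + finrank prolong(U₀₁ ⊔ U₀₂)` for `U₀₁ = span {u, a}`, `a ∉ U₀₂`,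
# `finrank U₁₂ ≤ 2` — and the easy leaf of the `(2,2,2)♭` COMMON-LINE profile

Brick 3 (part 1) of the `(2,2,2)♭` residue of the K1 lane (val-port-2 g6 ↔ crit-3 g9, 2026-08-29).  Generalises the count of
✓ `finrank_le_five_of_line_in_two_planes` (the case `a = 0`): by ✓ `L3_finite_form`, `T_μ(p,q,r) = A_r(p,q) + B_q(p,r) + C_p(q,r)` with
`A_x = s_x u + t_x a ∈ U₀₁`, `B_x ∈ U₀₂`, `C_x ∈ U₁₂`; the two pencils `G¹_x := A_x − B_x`, `G²_x := A_x − C_x` are FULLY symmetric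
(slot symmetries `(2 3)`, `(1 3)` of `T_μ` and the symmetry of `C_x`, `B_x`), so `G¹ ∈ prolong (U₀₁ ⊔ U₀₂)`, `G² ∈ prolong (U₀₁ ⊔ U₁₂)` and
`T_μ = Sym(u ⊗ s) + Sym(a ⊗ t) − G¹ − G²` on the representation space `R ∋ (s, t, G¹, G²)` with the linkages `A_x − G¹_x ∈ U₀₂`,
`A_x − G²_x ∈ U₁₂`.  On `R ⊓ {s = 0, G¹ = 0}` the first linkage reads `t_x a ∈ U₀₂`, so `t = 0` (`a ∉ U₀₂`), the second puts `G²` in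
`prolong U₁₂`, and `T_μ = −G²` square-free forces `G² = 0` (✓ `prolong_sup_sqfree_eq_zero`, `finrank U₁₂ ≤ 2`): the projection
`(s, G¹)` is injective on the obligations, `finrank W ≤ 5 + finrank prolong (U₀₁ ⊔ U₀₂)` (✓ `finrank_map_le_add`, ✓ `hub_injective`).

* ★★ `finrank_le_five_add_prolong` — the count.
* ★ `captureIneqSym_of_common_line_of_prolong_le_one` — the COMMON-LINE profile `U₀₁ = ⟨u,a⟩, U₀₂ = ⟨u,b⟩, U₁₂ = ⟨u,c⟩`
  (`a ∉ U₀₂`) with `finrank prolong ⟨u,a,b⟩ ≤ 1`: `finrank W ≤ 6`.  Census of record (val-port-2 g6 `cl5.py`, 2 000 structured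
  common-line configurations): some pairwise sum `U_i ⊔ U_j` has prolongation `≤ 1` in 1 663 (closed here, up to the slot relabelling
  of ✓ `contractZ_mem_L3_swap23/13`); the residue «all three pairwise prolongations ≥ 2» (337: squares, binary nets, `ℓ·L` nets) has
  true capacity `≤ 3` throughout and is NOT closed here.

Honest framing.  A count and ONE leaf of the common-line profile; the residue above, every profile with a span of `finrank ≥ 3` outside the
landed cells, `CaptureIneqSym` in general, K1 on `K₃ ⊔ K₂`, `LaplaceOptimalFive` (OPEN · CONTESTED 72/120), `RankRigidMinimalRepr` and
`VP ≠ VNP` are NOT proved here.  No definitions, no `sorry`.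
-/

set_option linter.dupNamespace false
set_option autoImplicit false

namespace Summit.ValiantsHypothesis.ValiantsHypothesis.Theorems.RigidityForcesSymmetryRankRigidMinimalRepr

namespace LaplaceFiveSeparatedCapture

open Finset

/-- ★★ **PENCIL-PLUS-GENERATOR COUNT.**  `U₀₁ = span {u, a}` with `u, a` symmetric and `a ∉ U₀₂`; `U₀₂`, `U₁₂` symmetric with
`finrank U₁₂ ≤ 2`.  Every space `W` of symmetric zero-diagonal leaf matrices captured by `L3 U₀₁ U₀₂ U₁₂` has
`finrank W ≤ 5 + finrank prolong (U₀₁ ⊔ U₀₂)`. [folklore] -/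
theorem finrank_le_five_add_prolong (u a : Fin 5 → Fin 5 → ℂ) (hu : ∀ p q, u p q = u q p) (ha : ∀ p q, a p q = a q p)
    (U02 U12 W : Submodule ℂ (Fin 5 → Fin 5 → ℂ))
    (h02s : ∀ x ∈ U02, ∀ p q : Fin 5, x p q = x q p) (h12s : ∀ x ∈ U12, ∀ p q : Fin 5, x p q = x q p)
    (haU : a ∉ U02) (h12 : Module.finrank ℂ U12 ≤ 2)
    (hWs : ∀ μ ∈ W, ∀ s t : Fin 5, μ s t = μ t s) (hWd : ∀ μ ∈ W, ∀ s : Fin 5, μ s s = 0)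
    (hWc : ∀ μ ∈ W, contractZ μ ∈ L3 (Submodule.span ℂ ({u, a} : Set (Fin 5 → Fin 5 → ℂ))) U02 U12) :
    Module.finrank ℂ W ≤ 5 + Module.finrank ℂ (prolong (Submodule.span ℂ ({u, a} : Set (Fin 5 → Fin 5 → ℂ)) ⊔ U02)) := by
  classical
  set P : Submodule ℂ (Fin 5 → Fin 5 → ℂ) := Submodule.span ℂ ({u, a} : Set (Fin 5 → Fin 5 → ℂ)) with hPdef
  have huP : u ∈ P := Submodule.subset_span (by simp)
  have haP : a ∈ P := Submodule.subset_span (by simp)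
  have hPs : ∀ x ∈ P, ∀ p q : Fin 5, x p q = x q p := by
    intro x hx p q
    obtain ⟨c, d, rfl⟩ := Submodule.mem_span_pair.mp hx
    simp only [Pi.add_apply, Pi.smul_apply, smul_eq_mul, hu p q, ha p q]
  -- placements
  let symU : (Fin 5 → ℂ) →ₗ[ℂ] (Fin 5 → Fin 5 → Fin 5 → ℂ) :=
    { toFun := fun z p q r => z p * u q r + z q * u p r + z r * u p q
      map_add' := fun z y => by funext p q r; simp only [Pi.add_apply]; ring
      map_smul' := fun c z => by funext p q r; simp only [Pi.smul_apply, smul_eq_mul, RingHom.id_apply]; ring }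
  let symA : (Fin 5 → ℂ) →ₗ[ℂ] (Fin 5 → Fin 5 → Fin 5 → ℂ) :=
    { toFun := fun z p q r => z p * a q r + z q * a p r + z r * a p q
      map_add' := fun z y => by funext p q r; simp only [Pi.add_apply]; ring
      map_smul' := fun c z => by funext p q r; simp only [Pi.smul_apply, smul_eq_mul, RingHom.id_apply]; ring }
  let tensUA : ((Fin 5 → ℂ) × (Fin 5 → ℂ)) →ₗ[ℂ] (Fin 5 → Fin 5 → Fin 5 → ℂ) :=
    { toFun := fun z x q r => z.1 x * u q r + z.2 x * a q r
      map_add' := fun z y => by funext x q r; simp only [Prod.fst_add, Prod.snd_add, Pi.add_apply]; ring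
      map_smul' := fun c z => by
        funext x q r; simp only [Prod.smul_fst, Prod.smul_snd, Pi.smul_apply, smul_eq_mul, RingHom.id_apply]; ring }
  -- representation space `(s, t, G¹, G²)`
  let Xsp := ((Fin 5 → ℂ) × (Fin 5 → ℂ)) × ((Fin 5 → Fin 5 → Fin 5 → ℂ) × (Fin 5 → Fin 5 → Fin 5 → ℂ))
  let πst : Xsp →ₗ[ℂ] ((Fin 5 → ℂ) × (Fin 5 → ℂ)) := LinearMap.fst ℂ _ _
  let πs : Xsp →ₗ[ℂ] (Fin 5 → ℂ) := (LinearMap.fst ℂ _ _).comp πst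
  let πt : Xsp →ₗ[ℂ] (Fin 5 → ℂ) := (LinearMap.snd ℂ _ _).comp πst
  let πG1 : Xsp →ₗ[ℂ] (Fin 5 → Fin 5 → Fin 5 → ℂ) := (LinearMap.fst ℂ _ _).comp (LinearMap.snd ℂ _ _)
  let πG2 : Xsp →ₗ[ℂ] (Fin 5 → Fin 5 → Fin 5 → ℂ) := (LinearMap.snd ℂ _ _).comp (LinearMap.snd ℂ _ _)
  let Φ : Xsp →ₗ[ℂ] (Fin 5 → Fin 5 → Fin 5 → ℂ) := symU.comp πs + symA.comp πt - πG1 - πG2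
  let lamB : Xsp →ₗ[ℂ] (Fin 5 → Fin 5 → Fin 5 → ℂ) := tensUA.comp πst - πG1
  let lamC : Xsp →ₗ[ℂ] (Fin 5 → Fin 5 → Fin 5 → ℂ) := tensUA.comp πst - πG2
  have hΦ : ∀ x : Xsp, ∀ p q r, Φ x p q r = (x.1.1 p * u q r + x.1.1 q * u p r + x.1.1 r * u p q)
      + (x.1.2 p * a q r + x.1.2 q * a p r + x.1.2 r * a p q) - x.2.1 p q r - x.2.2 p q r := fun x p q r => rfl
  have hlamB : ∀ x : Xsp, ∀ y q r, lamB x y q r = x.1.1 y * u q r + x.1.2 y * a q r - x.2.1 y q r := fun x y q r => rfl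
  have hlamC : ∀ x : Xsp, ∀ y q r, lamC x y q r = x.1.1 y * u q r + x.1.2 y * a q r - x.2.2 y q r := fun x y q r => rfl
  have hπs : ∀ x : Xsp, πs x = x.1.1 := fun x => rfl
  have hπG1 : ∀ x : Xsp, πG1 x = x.2.1 := fun x => rfl
  have hπG2 : ∀ x : Xsp, πG2 x = x.2.2 := fun x => rfl
  let U02pi : Submodule ℂ (Fin 5 → Fin 5 → Fin 5 → ℂ) := Submodule.pi Set.univ (fun _ : Fin 5 => U02)
  let U12pi : Submodule ℂ (Fin 5 → Fin 5 → Fin 5 → ℂ) := Submodule.pi Set.univ (fun _ : Fin 5 => U12)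
  let R : Submodule ℂ Xsp := (W.map cZ).comap Φ ⊓ ((prolong (P ⊔ U02)).comap πG1 ⊓ ((prolong (P ⊔ U12)).comap πG2 ⊓
    (U02pi.comap lamB ⊓ U12pi.comap lamC)))
  -- the kernel of the projection `(s, G¹)`: `t = 0`, then `G² ∈ prolong U₁₂` square-free, so `G² = 0`
  have hker : ∀ x ∈ R, πG1 x = 0 → πs x = 0 → x = 0 := by
    intro x hx hG10 hs0
    obtain ⟨hxW, hx2⟩ := Submodule.mem_inf.mp hx
    obtain ⟨-, hx3⟩ := Submodule.mem_inf.mp hx2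
    obtain ⟨hxG2, hx4⟩ := Submodule.mem_inf.mp hx3
    obtain ⟨hxB, hxC⟩ := Submodule.mem_inf.mp hx4
    rw [Submodule.mem_comap, Submodule.mem_pi] at hxB hxC
    rw [Submodule.mem_comap, hπG2] at hxG2
    rw [hπG1] at hG10
    rw [hπs] at hs0
    -- `t = 0`
    have ht0 : x.1.2 = 0 := by
      funext y
      by_contra hty
      have hy := hxB y (Set.mem_univ y)
      have e : lamB x y = x.1.2 y • a := by
        funext q r
        show x.1.1 y * u q r + x.1.2 y * a q r - x.2.1 y q r = (x.1.2 y • a) q r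
        rw [hs0, hG10]
        simp
      rw [e] at hy
      have : a ∈ U02 := by
        have h2 := U02.smul_mem (x.1.2 y)⁻¹ hy
        rwa [smul_smul, inv_mul_cancel₀ hty, one_smul] at h2
      exact haU this
    -- `G² ∈ prolong U₁₂`
    obtain ⟨hG12, hG23, -⟩ := (mem_prolong_iff _ _).mp hxG2
    have hG2U : x.2.2 ∈ prolong U12 := by
      refine (mem_prolong_iff U12 _).mpr ⟨hG12, hG23, fun y => ?_⟩
      have hy := hxC y (Set.mem_univ y)
      have e : lamC x y = -(x.2.2 y) := by
        funext q r
        show x.1.1 y * u q r + x.1.2 y * a q r - x.2.2 y q r = (-(x.2.2 y)) q r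
        rw [hs0, ht0]
        simp
      rw [e] at hy
      have h2 := U12.neg_mem hy
      rwa [neg_neg] at h2
    -- `T_μ = −G²` is square-free, hence `G² = 0`
    rw [Submodule.mem_comap] at hxW
    obtain ⟨μ, -, hμ⟩ := Submodule.mem_map.mp hxW
    have hΦx : Φ x = -x.2.2 := by
      funext p q r
      rw [hΦ, hs0, ht0, hG10]
      simp
    have hsup : Module.finrank ℂ ↥(U12 ⊔ U12) ≤ 3 := by rw [sup_idem]; omega
    have hz : x.2.2 + 0 = 0 := prolong_sup_sqfree_eq_zero U12 U12 h12s h12s h12 h12 hsup x.2.2 0 hG2U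
      (Submodule.zero_mem _) fun p r => by
        have e := congrFun (congrFun (congrFun hμ p) p) r
        rw [cZ_apply, contractZ_rep12, hΦx] at e
        rw [add_zero]
        simpa using e.symm
    rw [add_zero] at hz
    refine Prod.ext (Prod.ext hs0 ht0) (Prod.ext hG10 hz)
  -- every obligation lies in `Φ(R)`
  have hmem : ∀ μ ∈ W, contractZ μ ∈ R.map Φ := by
    intro μ hμ
    obtain ⟨A, B, C, hA, hB, hC, hT⟩ := L3_finite_form P U02 U12 (hWc μ hμ)
    have hAc : ∀ y, ∃ c d : ℂ, c • u + d • a = A y := fun y => Submodule.mem_span_pair.mp (hA y)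
    choose s t hst using hAc
    have hA' : ∀ y p q, A y p q = s y * u p q + t y * a p q := fun y p q => by
      rw [← hst y]; simp only [Pi.add_apply, Pi.smul_apply, smul_eq_mul]
    have hAs : ∀ y p q, A y p q = A y q p := fun y => hPs _ (hA y)
    let G1 : Fin 5 → Fin 5 → Fin 5 → ℂ := fun x y z => A x y z - B x y z
    let G2 : Fin 5 → Fin 5 → Fin 5 → ℂ := fun x y z => A x y z - C x y z
    have hG1d : ∀ x y z, G1 x y z = A x y z - B x y z := fun _ _ _ => rfl
    have hG2d : ∀ x y z, G2 x y z = A x y z - C x y z := fun _ _ _ => rfl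
    have h1_23 : ∀ x y z, G1 x y z = G1 x z y := fun x y z => by rw [hG1d, hG1d, hAs x y z, h02s _ (hB x) y z]
    have h2_23 : ∀ x y z, G2 x y z = G2 x z y := fun x y z => by rw [hG2d, hG2d, hAs x y z, h12s _ (hC x) y z]
    have h1_13 : ∀ x y z, G1 x y z = G1 z y x := fun x y z => by
      have h := contractZ_swap23 μ y x z
      rw [hT, hT] at h
      have hc := h12s _ (hC y) z x
      rw [hG1d, hG1d]
      linear_combination h - hc
    have h2_13 : ∀ x y z, G2 x y z = G2 z y x := fun x y z => by
      have h : contractZ μ z y x = contractZ μ x y z := by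
        rw [contractZ_swap12 μ y z x, contractZ_swap23 μ y x z, contractZ_swap12 μ x y z]
      rw [hT, hT, hAs x z y, hAs z x y] at h
      have hb := h02s _ (hB y) z x
      rw [hG2d, hG2d]
      linear_combination h - hb
    have h1_12 : ∀ x y z, G1 x y z = G1 y x z := fun x y z => by rw [h1_23 y x z, h1_13 y z x, h1_23 x z y]
    have h2_12 : ∀ x y z, G2 x y z = G2 y x z := fun x y z => by rw [h2_23 y x z, h2_13 y z x, h2_23 x z y]
    have hAx : ∀ x, A x = s x • u + t x • a := fun x => by
      funext p q; rw [hA']; simp only [Pi.add_apply, Pi.smul_apply, smul_eq_mul]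
    have hG1p : G1 ∈ prolong (P ⊔ U02) := by
      refine (mem_prolong_iff _ G1).mpr ⟨h1_12, h1_23, fun x => ?_⟩
      have e : G1 x = A x - B x := by funext y z; rw [hG1d, Pi.sub_apply, Pi.sub_apply]
      rw [e]
      exact Submodule.sub_mem _ (Submodule.mem_sup_left (hA x)) (Submodule.mem_sup_right (hB x))
    have hG2p : G2 ∈ prolong (P ⊔ U12) := by
      refine (mem_prolong_iff _ G2).mpr ⟨h2_12, h2_23, fun x => ?_⟩
      have e : G2 x = A x - C x := by funext y z; rw [hG2d, Pi.sub_apply, Pi.sub_apply]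
      rw [e]
      exact Submodule.sub_mem _ (Submodule.mem_sup_left (hA x)) (Submodule.mem_sup_right (hC x))
    have hrep : Φ ((s, t), (G1, G2)) = contractZ μ := by
      funext p q r
      rw [hΦ, hT p q r]
      show (s p * u q r + s q * u p r + s r * u p q) + (t p * a q r + t q * a p r + t r * a p q) - G1 p q r - G2 p q r
        = A r p q + B q p r + C p q r
      rw [h1_12 p q r, hG1d, hG2d, hA' r p q, hA' q p r, hA' p q r]
      ring
    refine Submodule.mem_map.mpr ⟨((s, t), (G1, G2)), ?_, hrep⟩
    refine Submodule.mem_inf.mpr ⟨?_, Submodule.mem_inf.mpr ⟨?_, Submodule.mem_inf.mpr ⟨?_, Submodule.mem_inf.mpr ⟨?_, ?_⟩⟩⟩⟩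
    · rw [Submodule.mem_comap, hrep]
      exact Submodule.mem_map.mpr ⟨μ, hμ, cZ_apply μ⟩
    · rw [Submodule.mem_comap]; exact hG1p
    · rw [Submodule.mem_comap]; exact hG2p
    · rw [Submodule.mem_comap, Submodule.mem_pi]
      intro y _
      have e : lamB ((s, t), (G1, G2)) y = B y := by
        funext q r
        rw [hlamB]
        show s y * u q r + t y * a q r - G1 y q r = B y q r
        rw [hG1d, hA']; ring
      rw [e]; exact hB y
    · rw [Submodule.mem_comap, Submodule.mem_pi]
      intro y _
      have e : lamC ((s, t), (G1, G2)) y = C y := by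
        funext q r
        rw [hlamC]
        show s y * u q r + t y * a q r - G2 y q r = C y q r
        rw [hG2d, hA']; ring
      rw [e]; exact hC y
  -- counting
  let f : W →ₗ[ℂ] (R.map Φ) := LinearMap.codRestrict (R.map Φ) (cZ.domRestrict W) (fun μ => by
    simpa [cZ_apply] using hmem μ.1 μ.2)
  have hf : Function.Injective f := by
    rw [injective_iff_map_eq_zero]
    intro μ hμ
    have hT : contractZ μ.1 = 0 := by
      have := congrArg Subtype.val hμ
      simpa [f, cZ_apply] using this
    apply Subtype.ext
    refine hub_injective μ.1 (hWs μ.1 μ.2) (hWd μ.1 μ.2) fun p q => ?_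
    simp [hT]
  have hW_le := LinearMap.finrank_le_finrank_of_injective hf
  have hadd := finrank_map_le_add Φ πG1 πs R hker
  have hπG1le : R.map πG1 ≤ prolong (P ⊔ U02) := by
    rw [Submodule.map_le_iff_le_comap]
    exact inf_le_right.trans inf_le_left
  have h1 : Module.finrank ℂ (R.map πG1) ≤ Module.finrank ℂ (prolong (P ⊔ U02)) := Submodule.finrank_mono hπG1le
  have h2 : Module.finrank ℂ ((R ⊓ LinearMap.ker πG1).map πs) ≤ 5 := by
    have := Submodule.finrank_le ((R ⊓ LinearMap.ker πG1).map πs)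
    rw [Module.finrank_fin_fun] at this
    exact this
  omega

/-- ★ **COMMON LINE, easy leaf.**  The `(2,2,2)♭` common-line profile `U₀₁ = ⟨u,a⟩`, `U₀₂ = ⟨u,b⟩`, `U₁₂ = ⟨u,c⟩` (symmetric, `a ∉ U₀₂`)
with `finrank prolong ⟨u, a, b⟩ ≤ 1` — precisely, `finrank prolong (U₀₁ ⊔ U₀₂) ≤ 1` — satisfies `finrank W ≤ 6 = 2 + 2 + 2`.
The other pairings follow by ✓ `contractZ_mem_L3_swap23` / `…swap13`; the residue «all three pairwise prolongations ≥ 2» is open. [folklore] -/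
theorem captureIneqSym_of_common_line_of_prolong_le_one (u a b c : Fin 5 → Fin 5 → ℂ)
    (hu : ∀ p q, u p q = u q p) (ha : ∀ p q, a p q = a q p) (hb : ∀ p q, b p q = b q p) (hc : ∀ p q, c p q = c q p)
    (haU : a ∉ Submodule.span ℂ ({u, b} : Set (Fin 5 → Fin 5 → ℂ)))
    (hp : Module.finrank ℂ (prolong (Submodule.span ℂ ({u, a} : Set (Fin 5 → Fin 5 → ℂ)) ⊔
      Submodule.span ℂ ({u, b} : Set (Fin 5 → Fin 5 → ℂ)))) ≤ 1)
    (W : Submodule ℂ (Fin 5 → Fin 5 → ℂ))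
    (hWs : ∀ μ ∈ W, ∀ s t : Fin 5, μ s t = μ t s) (hWd : ∀ μ ∈ W, ∀ s : Fin 5, μ s s = 0)
    (hWc : ∀ μ ∈ W, contractZ μ ∈ L3 (Submodule.span ℂ ({u, a} : Set (Fin 5 → Fin 5 → ℂ)))
      (Submodule.span ℂ ({u, b} : Set (Fin 5 → Fin 5 → ℂ))) (Submodule.span ℂ ({u, c} : Set (Fin 5 → Fin 5 → ℂ)))) :
    Module.finrank ℂ W ≤ 6 := by
  classical
  have hsym2 : ∀ v v' : Fin 5 → Fin 5 → ℂ, (∀ p q, v p q = v q p) → (∀ p q, v' p q = v' q p) →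
      ∀ x ∈ Submodule.span ℂ ({v, v'} : Set (Fin 5 → Fin 5 → ℂ)), ∀ p q : Fin 5, x p q = x q p := by
    intro v v' hv hv' x hx p q
    obtain ⟨c1, c2, rfl⟩ := Submodule.mem_span_pair.mp hx
    simp only [Pi.add_apply, Pi.smul_apply, smul_eq_mul, hv p q, hv' p q]
  have h12 : Module.finrank ℂ (Submodule.span ℂ ({u, c} : Set (Fin 5 → Fin 5 → ℂ))) ≤ 2 := by
    have h : Module.finrank ℂ (Submodule.span ℂ (↑({u, c} : Finset (Fin 5 → Fin 5 → ℂ)) : Set (Fin 5 → Fin 5 → ℂ))) ≤ 2 :=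
      (finrank_span_finset_le_card _).trans Finset.card_le_two
    have hset : (↑({u, c} : Finset (Fin 5 → Fin 5 → ℂ)) : Set (Fin 5 → Fin 5 → ℂ)) = {u, c} := by
      simp only [Finset.coe_insert, Finset.coe_singleton]
    rw [hset] at h
    exact h
  have := finrank_le_five_add_prolong u a hu ha _ _ W (hsym2 u b hu hb) (hsym2 u c hu hc) haU h12 hWs hWd hWc
  omega

end LaplaceFiveSeparatedCapture

end Summit.ValiantsHypothesis.ValiantsHypothesis.Theorems.RigidityForcesSymmetryRankRigidMinimalRepr
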